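import Summits.BirchSwinnertonDyer.BirchSwinnertonDyer.Theorems.Rank2ObservatoryAnomJoins5

/-!
# BirchSwinnertonDyer — rank ≥ 2 observatory: gen-8 harvest of the anom census joins (J3.9d long-budget 3-descent re-run, J8-g8, J9-g9,
gen-9 Ш-parts ledger) — DATA

HONEST FRAMING: per-curve certified theorems and census instruments; no claim on BSD in rank ≥ 2.

CENSUS DATA ONLY (REFEREE P6/R7: DATA-labelled `def`s, never theorems about elliptic curves); companion of `Rank2ObservatoryAnomJoins5` whose
structures it re-uses. Every `def` transcribes a number printed in `run/shared/lean/b2b/bsd-rank2-observatory/b2b-bsdr2-anom/CONSISTENCY-JOINS.md`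
§J3.9d, §J8-g8, §J9-g9 and §J7-g9 and its machine-readable source under `b2b-bsdr2-anom/joins-outputs/` (`desc3-budget18A-j107734/RUN.json`,
`desc3-budget18B-j107735/RUN.json`, `desc3-budget37-combined/RUN.json`, `JOIN-U3-g8.summary.json`, `REFRESH-REGRESSION-U3-g8.json`,
`JOIN-HEIGHTFREE-g9.summary.json`, `SHA-PARTS-LEDGER-g9.summary.json`; sha256 of every input recorded in each summary; re-verified by
`b2b-bsdr2-anom/MANIFEST-CHECK.md`). The census verdicts are unchanged: 358 159 rows consistent, anomalies under verification 0; the `Ш[3]` column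
is unchanged (the 18 n/a rows did not finish within 21 600 s of GRH-mode 3-descent and stay n/a — evidence, not a verdict); the height-free class
stays listed APART from the unconditional class; `GRH_BNF` is never counted as unconditional. The `example`s are bookkeeping identities by `decide`.
-/

namespace Summit.BirchSwinnertonDyer.BirchSwinnertonDyer.Rank2Observatory.AnomJoins6
open Summit.BirchSwinnertonDyer.BirchSwinnertonDyer.Rank2Observatory.AnomJoins5

/-! ## J3.9d — long-budget re-run of the 18 `Ш[3]`-column n/a rows (surjective mod-3 image; one row per worker, `JOB_TOP = 21600` s, GRH mode,
10⁶ tries; engine `code/b2b-bsdr2-anom/desc3/` verbatim; jobs j107734 = group A, j107735 = group B, 9 cores / 40 GB / 6.4 h each) -/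

/-- DATA (not a theorem): one long-budget desc3 run: rows, rows finished (`ok`), rows killed by the supervisor at the per-curve cap, rows missing
from the output, per-curve cap in seconds, exit code, anomalies under verification. -/
structure BudgetRun where
  (rows ok killed missing topSeconds exitCode anomaliesUnderVerification : Nat)
  job : String
  deriving Repr, DecidableEq

/-- DATA (not a theorem): `desc3-budget18A-j107734/RUN.json`. -/
def budgetEighteenA : BudgetRun :=
  { rows := 9, ok := 0, killed := 9, missing := 0, topSeconds := 21600, exitCode := 0, anomaliesUnderVerification := 0, job := "j107734" }

/-- DATA (not a theorem): `desc3-budget18B-j107735/RUN.json`. -/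
def budgetEighteenB : BudgetRun :=
  { rows := 9, ok := 0, killed := 9, missing := 0, topSeconds := 21600, exitCode := 0, anomaliesUnderVerification := 0, job := "j107735" }

/-- DATA (not a theorem): the rebuilt 37-row combined budget table `desc3-budget37-combined/RUN.json` (per label: j093833 base row overridden by the
follow-up rows of j101463, j101464, j107734, j107735; a non-ok follow-up never hides an ok row): rows, `ok` rows (token `GRH_BNF`, all with
`dim Sel₃ = r`, `dim Ш[3] ≥ 0` attained), rows not finished, ok rows contributed by j093833 / j101463, killed rows now carried by j107734 / j107735,
number of jobs combined, anomalies under verification. -/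
structure BudgetCombined where
  (rows ok okSelEqR notFinished okBase okFollowUpOne killedA killedB jobs anomaliesUnderVerification : Nat)
  deriving Repr, DecidableEq

/-- DATA (not a theorem): `desc3-budget37-combined/RUN.json` (gen-8 version; the gen-5 and gen-6 versions are kept as `desc3.v5.jsonl`,
`desc3.v6.jsonl`). -/
def budgetCombinedG8 : BudgetCombined :=
  { rows := 37, ok := 19, okSelEqR := 19, notFinished := 18, okBase := 17, okFollowUpOne := 2, killedA := 9, killedB := 9, jobs := 5,
    anomaliesUnderVerification := 0 }

example : budgetEighteenA.ok = 0 ∧ budgetEighteenB.ok = 0 ∧ budgetEighteenA.killed = budgetEighteenA.rows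
    ∧ budgetEighteenB.killed = budgetEighteenB.rows
    ∧ budgetEighteenA.missing = 0 ∧ budgetEighteenB.missing = 0 ∧ budgetEighteenA.topSeconds = 21600 ∧ budgetEighteenB.topSeconds = 21600
    ∧ budgetEighteenA.rows + budgetEighteenB.rows = budgetCombinedG8.notFinished
    ∧ budgetCombinedG8.killedA = budgetEighteenA.killed ∧ budgetCombinedG8.killedB = budgetEighteenB.killed
    ∧ budgetCombinedG8.ok + budgetCombinedG8.notFinished = budgetCombinedG8.rows ∧ budgetCombinedG8.okSelEqR = budgetCombinedG8.ok
    ∧ budgetCombinedG8.okBase + budgetCombinedG8.okFollowUpOne = budgetCombinedG8.ok ∧ budgetCombinedG8.anomaliesUnderVerification = 0 := by decide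
/-- The census `Ш[3]` column is unchanged by J3.9d: the gen-9 ledger has the same three p = 3 counts as the gen-8 ledger, and its n/a count is the
not-finished count of the combined budget table. -/
example : (ledgerByPrimeG8.filter (·.p = 3)).map (·.unconditional) = [ledgerTotalsG8.shaThreeUnconditional]
    ∧ ledgerTotalsG8.shaThreeNa = budgetCombinedG8.notFinished := by decide

/-! ## J8-g8 — J8 re-run after padic-3's deep batch 3 (`U3-DEEP3.jsonl`: 49693a1 at top level 3¹¹) -/

/-- DATA (not a theorem): `JOIN-U3-g8.summary.json: counts` and `REFRESH-REGRESSION-U3-g8.json`: rows, good-ordinary cells consistent (by rank),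
undetermined ordinary cells, supersingular rows with MT weak vanishing consistent, calibration rows not in the census, deep overrides used, rows
byte-identical to the gen-6b table of record, changed rows, anomalies under verification; output sha. -/
structure UThreeRefresh where
  (rows ordinaryConsistent ordinaryConsistentRankTwo ordinaryConsistentRankThree ordinaryUndetermined supersingularMtConsistent : Nat)
  (notInCensus deepOverridesUsed identicalRows changedRows anomaliesUnderVerification : Nat)
  outputSha256 : String
  deriving Repr, DecidableEq

/-- DATA (not a theorem): J8-g8. -/
def uThreeRefreshG8 : UThreeRefresh :=
  { rows := 20184, ordinaryConsistent := 13497, ordinaryConsistentRankTwo := 13251, ordinaryConsistentRankThree := 246, ordinaryUndetermined := 0,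
    supersingularMtConsistent := 6682, notInCensus := 5, deepOverridesUsed := 67, identicalRows := 20183, changedRows := 1,
    anomaliesUnderVerification := 0, outputSha256 := "5cab8ea4e553a472" }

example : uThreeRefreshG8.ordinaryConsistentRankTwo + uThreeRefreshG8.ordinaryConsistentRankThree = uThreeRefreshG8.ordinaryConsistent
    ∧ uThreeRefreshG8.ordinaryUndetermined = 0 ∧ uThreeRefreshG8.identicalRows + uThreeRefreshG8.changedRows = uThreeRefreshG8.rows
    ∧ uThreeRefreshG8.ordinaryConsistent + uThreeRefreshG8.supersingularMtConsistent + uThreeRefreshG8.notInCensus = uThreeRefreshG8.rows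
    ∧ uThreeRefreshG8.ordinaryConsistent = ledgerTotalsG8.uThreeSAEqS + ledgerTotalsG8.uThreeUndetermined
    ∧ uThreeRefreshG8.anomaliesUnderVerification = 0 := by decide

/-! ## J9-g9 — the height-free unit-cell instrument re-run on 89 atlas files (parts R2A59, R3A19–21, R3A24–28 landed after J9-g8) -/

/-- DATA (not a theorem): `JOIN-HEIGHTFREE-g9.summary.json: counts / inputs.lean_atlas / output` (structure `AnomJoins5.HeightFreeJoin`). -/
def heightFreeG9 : HeightFreeJoin :=
  { atlasFiles := 89, atlasDefs := 2307, atlasCurves := 2022, cells := 3800, cellsRankTwo := 3094, cellsRankThree := 706,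
    pFive := 1483, pSeven := 1531, pEleven := 573, pThirteen := 213, unitAgree := 3800, cleanUnitCells := 3051,
    cleanRankTwo := 2466, cleanRankThree := 585, cleanPFive := 909, cleanPSeven := 1375, cleanPEleven := 559, cleanPThirteen := 208,
    cleanUnitCurves := 1821, naAnomalous := 376, naNonUnit := 283, naPTam := 174, naGalrepNonsurjective := 5, naSurjNotCertified := 3,
    tPass := 3424, pPass := 3051, pCheckedValues := 17766, kuriharaBoth := 2501, kuriharaHeightFreeOnly := 550, consistent := 3800,
    anomaliesUnderVerification := 0, outputSha256 := "aafd19bea654c1e0" }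

example : heightFreeG9.bookkeeping ∧ heightFreeG9.atlasFiles = heightFreeG8.atlasFiles + 9 ∧ heightFreeG9.cellsRankTwo = heightFreeG8.cellsRankTwo + 6
    ∧ heightFreeG9.cellsRankThree = heightFreeG8.cellsRankThree + 126 ∧ heightFreeG8.cleanUnitCells ≤ heightFreeG9.cleanUnitCells
    ∧ heightFreeG8.cleanUnitCurves ≤ heightFreeG9.cleanUnitCurves := by decide

/-! ## J7-g9 — the gen-9 Ш-parts ledger `SHA-PARTS-LEDGER-g9` (ONE refresh with everything harvested in gen 8: p ≥ 5 digest
`SHA-PINF-CERTIFIED-g8.tsv`, instrument column `JOIN-U3-g8`, height-free class `JOIN-HEIGHTFREE-g9`, budget table with j107734 + j107735; the earlier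
ledgers are kept) -/

/-- DATA (not a theorem): `SHA-PARTS-LEDGER-g9.summary.json` per prime (structure `AnomJoins5.LedgerByPrime`: unconditional / GRH-only /
height-free-named-facts rows, three separate columns). -/
def ledgerByPrimeG9 : List LedgerByPrime := [
  { p := 2, unconditional := 358159, grhOnly := 0, heightFreeNamedFacts := 0 },
  { p := 3, unconditional := 18331, grhOnly := 339810, heightFreeNamedFacts := 0 },
  { p := 5, unconditional := 14660, grhOnly := 0, heightFreeNamedFacts := 909 },
  { p := 7, unconditional := 17816, grhOnly := 0, heightFreeNamedFacts := 1375 },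
  { p := 11, unconditional := 19890, grhOnly := 0, heightFreeNamedFacts := 559 },
  { p := 13, unconditional := 19240, grhOnly := 0, heightFreeNamedFacts := 208 } ]

/-- DATA (not a theorem): `SHA-PARTS-LEDGER-g9.summary.json` k histograms (structure `AnomJoins5.LedgerKHist`). -/
def ledgerKHistG9 : List LedgerKHist := [
  { k := 1, rowsUnconditional := 316050, rowsWithGrh := 18, hfRowsAnyClass := 0 },
  { k := 2, rowsUnconditional := 18404, rowsWithGrh := 332826, hfRowsAnyClass := 0 },
  { k := 3, rowsUnconditional := 6398, rowsWithGrh := 1728, hfRowsAnyClass := 19 },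
  { k := 4, rowsUnconditional := 10771, rowsWithGrh := 6747, hfRowsAnyClass := 178 },
  { k := 5, rowsUnconditional := 6256, rowsWithGrh := 10976, hfRowsAnyClass := 808 },
  { k := 6, rowsUnconditional := 280, rowsWithGrh := 5864, hfRowsAnyClass := 816 } ]

/-- DATA (not a theorem): `SHA-PARTS-LEDGER-g9.summary.json` totals (structure `AnomJoins5.LedgerTotalsG8`, same fields). -/
def ledgerTotalsG9 : LedgerTotalsG8 :=
  { rows := 358159, rowsAllOfFiveSevenElevenThirteen := 5864, rowsSomePrimeGeFive := 25315, shaThreeUnconditional := 18331, shaThreeGrhBnf := 339810,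
    shaThreeNa := 18, uThreeSAEqS := 13497, uThreeUndetermined := 0, uThreeSupersingularMt := 6682, padicInstrumentLabels := 16774,
    padicNonConsistent := 0, sFourRows := 42, sFourRowsTwoEngineOrderFour := 42, hfCells := 3051, hfRows := 1821, hfRowsRankTwo := 1616,
    hfRowsRankThree := 205, hfCellsAlsoJFour := 2502, hfCellsBeyondJFour := 549, hfRowsWithPrimeBeyondJFour := 233, hfRowsFirstRoute := 121,
    sFourRowsWithHf := 0, flags := 0, outputSha256 := "e2ca623589ed9c7f" }

/-- Bookkeeping of the gen-9 ledger and its relation to the gen-8 ledger: the unconditional and GRH columns are IDENTICAL per prime and per k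
(nothing new was proved unconditionally by the harvest; the 18 n/a rows stay n/a), the instrument column gained the one resolved deep cell, and
the height-free class is the J9-g9 join. -/
example : (ledgerByPrimeG9.map fun x => (x.p, x.unconditional, x.grhOnly)) = (ledgerByPrimeG8.map fun x => (x.p, x.unconditional, x.grhOnly))
    ∧ (ledgerKHistG9.map fun x => (x.k, x.rowsUnconditional, x.rowsWithGrh)) = (ledgerKHistG8.map fun x => (x.k, x.rowsUnconditional, x.rowsWithGrh))
    ∧ ledgerTotalsG9.rows = ledgerTotalsG8.rows ∧ ledgerTotalsG9.shaThreeNa = ledgerTotalsG8.shaThreeNa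
    ∧ ledgerTotalsG9.shaThreeUnconditional = ledgerTotalsG8.shaThreeUnconditional ∧ ledgerTotalsG9.shaThreeGrhBnf = ledgerTotalsG8.shaThreeGrhBnf
    ∧ ledgerTotalsG9.uThreeSAEqS = ledgerTotalsG8.uThreeSAEqS + 1 ∧ ledgerTotalsG9.uThreeUndetermined = 0
    ∧ ledgerTotalsG9.uThreeSAEqS = uThreeRefreshG8.ordinaryConsistent
    ∧ ledgerTotalsG9.hfCells = heightFreeG9.cleanUnitCells ∧ ledgerTotalsG9.hfRows = heightFreeG9.cleanUnitCurves
    ∧ (ledgerByPrimeG9.filter (5 ≤ ·.p)).map (·.heightFreeNamedFacts)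
      = [heightFreeG9.cleanPFive, heightFreeG9.cleanPSeven, heightFreeG9.cleanPEleven, heightFreeG9.cleanPThirteen]
    ∧ (ledgerKHistG9.map (·.hfRowsAnyClass)).sum = ledgerTotalsG9.hfRows
    ∧ ledgerTotalsG9.hfCellsAlsoJFour + ledgerTotalsG9.hfCellsBeyondJFour = ledgerTotalsG9.hfCells
    ∧ ledgerTotalsG9.hfRowsRankTwo + ledgerTotalsG9.hfRowsRankThree = ledgerTotalsG9.hfRows
    ∧ ledgerTotalsG9.flags = 0 ∧ ledgerTotalsG9.padicNonConsistent = 0 ∧ ledgerTotalsG9.sFourRowsWithHf = 0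
    ∧ ledgerTotalsG9.sFourRowsTwoEngineOrderFour = ledgerTotalsG9.sFourRows := by decide

end Summit.BirchSwinnertonDyer.BirchSwinnertonDyer.Rank2Observatory.AnomJoins6
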